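import Summits.CriticalPhenomena.CardyFormulaZ2.Theorems.CardyGluingRDEBoxMergingDyadicSquare

/-!
# `CardyGluingRDE.BoxMerging`: crossing events refine along the dyadic hierarchy
# (stmt-CriticalPhenomena-8582)

Route `CardyGluingRDE` (sub-problem `CardyFormulaZ2`) measures the distance between the
bond-`ℤ²` (mesh `u`) and site-`𝕋` (mesh `u'`) percolation laws of the square window `(0, δ₀)²`
through the family `TV_j(u,u')` = total variation between the two laws of the resolution-`j`
STATE, the Boolean matrix "dyadic boundary segment `a` is joined to segment `b` inside the
square" (`4·2^j` closed segments `seg δ₀ j a`, G02 events `discreteCrossing` / `triCrossing`);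
item `BoxMerging` (stmt-CriticalPhenomena-8582) asks `TV_j(u,u') → 0` as `u, u' → 0⁺` for every
`j`, and the crux `GluingContraction` works with the multiresolution sums
`Dw_K = Σ_{j ≤ K} 2^(−σj) TV_j` and their coarsening projections.

This file supplies the bookkeeping behind those projections — **the resolution-`j` state is a
deterministic readout of the resolution-`(j+1)` state, on both lattices**:

* `BoxMerging_stateEvent_coarsen` — for coarse events `C a b = ⋃_{a' ∈ ch a, b' ∈ ch b} E a' b'`
  built from fine events `E`, each coarse cell `{ω | ∀ a b, ω ∈ C a b ↔ M' a b}` is the union of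
  the fine cells over the fibre of the coarse-graining map `M ↦ (∃ children, M a' b')`;
* `BoxMerging_sum_abs_fiber_le` — the `ℓ¹` distance of two cell laws can only decrease under a
  common coarse-graining (additivity on fibres + triangle inequality);
* `BoxMerging_dyadic_split`, `BoxMerging_seg_succ` — a level-`j` segment is the union of its two
  level-`(j+1)` children (same side, child index `t'` with `⌊t'/2⌋ = t`);
* `BoxMerging_discreteCrossing_succ`, `BoxMerging_triCrossing_succ` — hence (discrete arcs of
  unions are unions of discrete arcs: `BoxMerging_discreteCrossing_biUnion`,
  `BoxMerging_triCrossing_biUnion` of `CardyGluingRDEBoxMergingArcUnions.lean`) the level-`j`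
  crossing event between `a` and `b` is the union of the level-`(j+1)` crossing events between
  their children, on `ℤ²` and on `𝕋`.

The consequence `TV_j ≤ TV_{j+1}` (and `BoxMerging` ⇔ merging at arbitrarily fine resolutions)
is drawn in `CardyGluingRDEBoxMergingResolution.lean`.
References: Langlands–Pouliot–Saint-Aubin, Bull. AMS 30 (1994) §2.3 (states of a square and
their coarse-grainings); Schramm–Smirnov, EJP 16 (2011) §1; Smirnov, C. R. Acad. Sci. 333 (2001)
§2 (discrete arcs).
-/

noncomputable section

namespace Summit.CriticalPhenomena.CardyFormulaZ2.Theorems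

open scoped BigOperators Topology
open Filter Set MeasureTheory
open Literature.Probability.Percolation Literature.Probability.RandomPlanarGeometry
  Literature.Probability.LatticeModels
open Summit.CriticalPhenomena.CardyFormulaZ2.Theses.CardyGluingRDE

/-! ### Coarse-graining a finite state -/

section Coarsen

variable {Ω α β : Type*}

/-- **Cells of a coarse-grained readout.**  Let `E a' b'` be "fine" events indexed by `β × β`,
`ch a ⊆ β` the children of a coarse index `a : α`, and `C a b = ⋃_{a' ∈ ch a, b' ∈ ch b} E a' b'`
the coarse events.  Then the coarse cell of a matrix `M'` ("the coarse matrix read from `ω` is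
`M'`") is the union, over the fine matrices `M` whose coarse-graining is `M'`, of the fine cells
of `M` (every `ω` reads exactly one fine matrix). [folklore] -/
theorem BoxMerging_stateEvent_coarsen [Fintype α] [Fintype β] [DecidableEq β] (E : β → β → Set Ω)
    (ch : α → Finset β) (M' : α → α → Bool) :
    {ω | ∀ a b, (ω ∈ ⋃ a' ∈ ch a, ⋃ b' ∈ ch b, E a' b') ↔ M' a b = true} =
      ⋃ M ∈ (Finset.univ.filter fun M : β → β → Bool =>
          (fun a b => decide (∃ a' ∈ ch a, ∃ b' ∈ ch b, M a' b' = true)) = M'),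
        {ω | ∀ a' b', ω ∈ E a' b' ↔ M a' b' = true} := by
  classical
  ext ω
  simp only [mem_setOf_eq, mem_iUnion, Finset.mem_filter, Finset.mem_univ, true_and, exists_prop]
  constructor
  · intro h
    refine ⟨fun a' b' => decide (ω ∈ E a' b'), ?_, fun a' b' => by simp⟩
    funext a b
    rw [Bool.eq_iff_iff, ← h a b]
    simp only [decide_eq_true_eq]
  · rintro ⟨M, hM, hω⟩ a b
    rw [← hM]
    simp only [decide_eq_true_eq, hω]

/-- **A common coarse-graining contracts the `ℓ¹` distance of two cell laws.**  For two finite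
measures, two families `E`, `F` of pairwise disjoint measurable events indexed by the same finite
type `X` and any map `g : X → Y` to a finite type:
`Σ_y |μ(⋃_{g x = y} E x) - ν(⋃_{g x = y} F x)| ≤ Σ_x |μ(E x) - ν(F x)|` (additivity on each fibre,
the triangle inequality, and re-summation over the fibres). [folklore] -/
theorem BoxMerging_sum_abs_fiber_le {Ω' X Y : Type*} [MeasurableSpace Ω] [MeasurableSpace Ω']
    [Fintype X] [Fintype Y] [DecidableEq Y] (g : X → Y) (μ : Measure Ω) (ν : Measure Ω')
    [IsFiniteMeasure μ] [IsFiniteMeasure ν] {E : X → Set Ω} {F : X → Set Ω'}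
    (hE : Pairwise (Function.onFun Disjoint E)) (hF : Pairwise (Function.onFun Disjoint F))
    (hEm : ∀ x, MeasurableSet (E x)) (hFm : ∀ x, MeasurableSet (F x)) :
    ∑ y, |μ.real (⋃ x ∈ (Finset.univ.filter fun x => g x = y), E x) -
        ν.real (⋃ x ∈ (Finset.univ.filter fun x => g x = y), F x)| ≤
      ∑ x, |μ.real (E x) - ν.real (F x)| := by
  calc ∑ y, |μ.real (⋃ x ∈ (Finset.univ.filter fun x => g x = y), E x) -
          ν.real (⋃ x ∈ (Finset.univ.filter fun x => g x = y), F x)|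
      ≤ ∑ y, ∑ x ∈ (Finset.univ.filter fun x => g x = y), |μ.real (E x) - ν.real (F x)| := by
        refine Finset.sum_le_sum fun y _ => ?_
        rw [measureReal_biUnion_finset (hE.set_pairwise _) (fun x _ => hEm x),
          measureReal_biUnion_finset (hF.set_pairwise _) (fun x _ => hFm x),
          ← Finset.sum_sub_distrib]
        exact Finset.abs_sum_le_sum_abs _ _
    _ = ∑ x, |μ.real (E x) - ν.real (F x)| := Finset.sum_fiberwise Finset.univ g _

end Coarsen

/-! ### Dyadic refinement of the boundary segments of the square -/

/-- **Dyadic bookkeeping**: the `t`-th closed level-`j` dyadic piece of `[0, δ₀]` is the union of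
the `t'`-th level-`(j+1)` pieces with `⌊t'/2⌋ = t`. [folklore] -/
theorem BoxMerging_dyadic_split {δ₀ : ℝ} (hδ₀ : 0 < δ₀) (j : ℕ) (t : Fin (2 ^ j)) (x : ℝ) :
    (δ₀ * ((t : ℕ) : ℝ) / 2 ^ j ≤ x ∧ x ≤ δ₀ * (((t : ℕ) : ℝ) + 1) / 2 ^ j) ↔
      ∃ t' : Fin (2 ^ (j + 1)), (t' : ℕ) / 2 = (t : ℕ) ∧
        δ₀ * ((t' : ℕ) : ℝ) / 2 ^ (j + 1) ≤ x ∧ x ≤ δ₀ * (((t' : ℕ) : ℝ) + 1) / 2 ^ (j + 1) := by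
  have hP : (0 : ℝ) < 2 ^ j := by positivity
  have h2 : (2 : ℝ) ^ (j + 1) = 2 * 2 ^ j := by rw [pow_succ, mul_comm]
  have ht : (t : ℕ) < 2 ^ j := t.2
  constructor
  · rintro ⟨h1, h1'⟩
    by_cases hx : x ≤ δ₀ * (2 * ((t : ℕ) : ℝ) + 1) / 2 ^ (j + 1)
    · refine ⟨⟨2 * (t : ℕ), by rw [pow_succ]; omega⟩, Nat.mul_div_cancel_left _ two_pos, ?_, ?_⟩
      · push_cast
        calc δ₀ * (2 * ((t : ℕ) : ℝ)) / 2 ^ (j + 1) = δ₀ * ((t : ℕ) : ℝ) / 2 ^ j := by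
              rw [h2]; field_simp
          _ ≤ x := h1
      · push_cast
        exact hx
    · refine ⟨⟨2 * (t : ℕ) + 1, by rw [pow_succ]; omega⟩, by
        show (2 * (t : ℕ) + 1) / 2 = (t : ℕ); omega, ?_, ?_⟩
      · push_cast
        exact (not_le.1 hx).le
      · push_cast
        calc x ≤ δ₀ * (((t : ℕ) : ℝ) + 1) / 2 ^ j := h1'
          _ = δ₀ * (2 * ((t : ℕ) : ℝ) + 1 + 1) / 2 ^ (j + 1) := by rw [h2]; field_simp; ring
  · rintro ⟨t', ht', h1, h1'⟩
    have hlo : 2 * (t : ℕ) ≤ (t' : ℕ) := by omega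
    have hhi : (t' : ℕ) ≤ 2 * (t : ℕ) + 1 := by omega
    have hlo' : (2 : ℝ) * ((t : ℕ) : ℝ) ≤ ((t' : ℕ) : ℝ) := by exact_mod_cast hlo
    have hhi' : ((t' : ℕ) : ℝ) ≤ 2 * ((t : ℕ) : ℝ) + 1 := by exact_mod_cast hhi
    constructor
    · calc δ₀ * ((t : ℕ) : ℝ) / 2 ^ j = δ₀ * (2 * ((t : ℕ) : ℝ)) / 2 ^ (j + 1) := by
            rw [h2]; field_simp
        _ ≤ δ₀ * ((t' : ℕ) : ℝ) / 2 ^ (j + 1) := by gcongr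
        _ ≤ x := h1
    · calc x ≤ δ₀ * (((t' : ℕ) : ℝ) + 1) / 2 ^ (j + 1) := h1'
        _ ≤ δ₀ * (2 * ((t : ℕ) : ℝ) + 1 + 1) / 2 ^ (j + 1) := by gcongr
        _ = δ₀ * (((t : ℕ) : ℝ) + 1) / 2 ^ j := by rw [h2]; field_simp; ring

/-- **A level-`j` dyadic boundary segment of the square is the union of its two level-`(j+1)`
children** (same side, child index `t'` with `⌊t'/2⌋ = t`); route notation `seg δ₀ j a`, inlined.
[folklore] -/
theorem BoxMerging_seg_succ {δ₀ : ℝ} (hδ₀ : 0 < δ₀) (j : ℕ) (a : Fin 4 × Fin (2 ^ j)) :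
    {z : ℂ | (a.1 = 0 ∧ z.im = 0 ∧ δ₀ * ((a.2 : ℕ) : ℝ) / 2 ^ j ≤ z.re ∧
          z.re ≤ δ₀ * (((a.2 : ℕ) : ℝ) + 1) / 2 ^ j) ∨
        (a.1 = 1 ∧ z.re = δ₀ ∧ δ₀ * ((a.2 : ℕ) : ℝ) / 2 ^ j ≤ z.im ∧
          z.im ≤ δ₀ * (((a.2 : ℕ) : ℝ) + 1) / 2 ^ j) ∨
        (a.1 = 2 ∧ z.im = δ₀ ∧ δ₀ * ((a.2 : ℕ) : ℝ) / 2 ^ j ≤ z.re ∧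
          z.re ≤ δ₀ * (((a.2 : ℕ) : ℝ) + 1) / 2 ^ j) ∨
        (a.1 = 3 ∧ z.re = 0 ∧ δ₀ * ((a.2 : ℕ) : ℝ) / 2 ^ j ≤ z.im ∧
          z.im ≤ δ₀ * (((a.2 : ℕ) : ℝ) + 1) / 2 ^ j)} =
      ⋃ a' ∈ (Finset.univ.filter fun a' : Fin 4 × Fin (2 ^ (j + 1)) =>
          a'.1 = a.1 ∧ (a'.2 : ℕ) / 2 = (a.2 : ℕ)),
        {z : ℂ | (a'.1 = 0 ∧ z.im = 0 ∧ δ₀ * ((a'.2 : ℕ) : ℝ) / 2 ^ (j + 1) ≤ z.re ∧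
            z.re ≤ δ₀ * (((a'.2 : ℕ) : ℝ) + 1) / 2 ^ (j + 1)) ∨
          (a'.1 = 1 ∧ z.re = δ₀ ∧ δ₀ * ((a'.2 : ℕ) : ℝ) / 2 ^ (j + 1) ≤ z.im ∧
            z.im ≤ δ₀ * (((a'.2 : ℕ) : ℝ) + 1) / 2 ^ (j + 1)) ∨
          (a'.1 = 2 ∧ z.im = δ₀ ∧ δ₀ * ((a'.2 : ℕ) : ℝ) / 2 ^ (j + 1) ≤ z.re ∧
            z.re ≤ δ₀ * (((a'.2 : ℕ) : ℝ) + 1) / 2 ^ (j + 1)) ∨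
          (a'.1 = 3 ∧ z.re = 0 ∧ δ₀ * ((a'.2 : ℕ) : ℝ) / 2 ^ (j + 1) ≤ z.im ∧
            z.im ≤ δ₀ * (((a'.2 : ℕ) : ℝ) + 1) / 2 ^ (j + 1))} := by
  ext z
  simp only [mem_setOf_eq, mem_iUnion, Finset.mem_filter, Finset.mem_univ, true_and, exists_prop]
  constructor
  · rintro (⟨h1, h2, h3⟩ | ⟨h1, h2, h3⟩ | ⟨h1, h2, h3⟩ | ⟨h1, h2, h3⟩)
    · obtain ⟨t', ht', h3'⟩ := (BoxMerging_dyadic_split hδ₀ j a.2 z.re).1 h3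
      exact ⟨(a.1, t'), ⟨rfl, ht'⟩, Or.inl ⟨h1, h2, h3'⟩⟩
    · obtain ⟨t', ht', h3'⟩ := (BoxMerging_dyadic_split hδ₀ j a.2 z.im).1 h3
      exact ⟨(a.1, t'), ⟨rfl, ht'⟩, Or.inr (Or.inl ⟨h1, h2, h3'⟩)⟩
    · obtain ⟨t', ht', h3'⟩ := (BoxMerging_dyadic_split hδ₀ j a.2 z.re).1 h3
      exact ⟨(a.1, t'), ⟨rfl, ht'⟩, Or.inr (Or.inr (Or.inl ⟨h1, h2, h3'⟩))⟩
    · obtain ⟨t', ht', h3'⟩ := (BoxMerging_dyadic_split hδ₀ j a.2 z.im).1 h3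
      exact ⟨(a.1, t'), ⟨rfl, ht'⟩, Or.inr (Or.inr (Or.inr ⟨h1, h2, h3'⟩))⟩
  · rintro ⟨a', ⟨hs, ht'⟩, h⟩
    rcases h with ⟨h1, h2, h3⟩ | ⟨h1, h2, h3⟩ | ⟨h1, h2, h3⟩ | ⟨h1, h2, h3⟩
    · exact Or.inl
        ⟨hs.symm.trans h1, h2, (BoxMerging_dyadic_split hδ₀ j a.2 z.re).2 ⟨a'.2, ht', h3⟩⟩
    · exact Or.inr (Or.inl
        ⟨hs.symm.trans h1, h2, (BoxMerging_dyadic_split hδ₀ j a.2 z.im).2 ⟨a'.2, ht', h3⟩⟩)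
    · exact Or.inr (Or.inr (Or.inl
        ⟨hs.symm.trans h1, h2, (BoxMerging_dyadic_split hδ₀ j a.2 z.re).2 ⟨a'.2, ht', h3⟩⟩))
    · exact Or.inr (Or.inr (Or.inr
        ⟨hs.symm.trans h1, h2, (BoxMerging_dyadic_split hδ₀ j a.2 z.im).2 ⟨a'.2, ht', h3⟩⟩))

/-- Every level-`j` segment has a level-`(j+1)` child (the one with index `2t`). [folklore] -/
theorem BoxMerging_children_nonempty (j : ℕ) (a : Fin 4 × Fin (2 ^ j)) :
    (Finset.univ.filter fun a' : Fin 4 × Fin (2 ^ (j + 1)) =>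
        a'.1 = a.1 ∧ (a'.2 : ℕ) / 2 = (a.2 : ℕ)).Nonempty :=
  ⟨(a.1, ⟨2 * (a.2 : ℕ), by have := a.2.2; rw [pow_succ]; omega⟩),
    Finset.mem_filter.2 ⟨Finset.mem_univ _, rfl, Nat.mul_div_cancel_left _ two_pos⟩⟩

/-- A single dyadic segment is not all of them (there are `4·2^j ≥ 4`). [folklore] -/
theorem BoxMerging_singleton_ne_univ (j : ℕ) (a : Fin 4 × Fin (2 ^ j)) :
    ({a} : Finset (Fin 4 × Fin (2 ^ j))) ≠ Finset.univ := by
  intro h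
  have h1 := congrArg Finset.card h
  rw [Finset.card_singleton, Finset.card_univ, Fintype.card_prod, Fintype.card_fin,
    Fintype.card_fin] at h1
  have : 1 ≤ 2 ^ j := Nat.one_le_two_pow
  omega

/-- A single dyadic boundary segment leaves out a point of the frontier of the square (the
non-exhaustion hypothesis of the `infDist` bookkeeping). [folklore] -/
theorem BoxMerging_frontier_diff_seg_nonempty {δ₀ : ℝ} (hδ₀ : 0 < δ₀) (j : ℕ)
    (a : Fin 4 × Fin (2 ^ j)) :
    (frontier {z : ℂ | 0 < z.re ∧ z.re < δ₀ ∧ 0 < z.im ∧ z.im < δ₀} \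
      {z : ℂ | (a.1 = 0 ∧ z.im = 0 ∧ δ₀ * ((a.2 : ℕ) : ℝ) / 2 ^ j ≤ z.re ∧
          z.re ≤ δ₀ * (((a.2 : ℕ) : ℝ) + 1) / 2 ^ j) ∨
        (a.1 = 1 ∧ z.re = δ₀ ∧ δ₀ * ((a.2 : ℕ) : ℝ) / 2 ^ j ≤ z.im ∧
          z.im ≤ δ₀ * (((a.2 : ℕ) : ℝ) + 1) / 2 ^ j) ∨
        (a.1 = 2 ∧ z.im = δ₀ ∧ δ₀ * ((a.2 : ℕ) : ℝ) / 2 ^ j ≤ z.re ∧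
          z.re ≤ δ₀ * (((a.2 : ℕ) : ℝ) + 1) / 2 ^ j) ∨
        (a.1 = 3 ∧ z.re = 0 ∧ δ₀ * ((a.2 : ℕ) : ℝ) / 2 ^ j ≤ z.im ∧
          z.im ≤ δ₀ * (((a.2 : ℕ) : ℝ) + 1) / 2 ^ j)}).Nonempty := by
  have h := BoxMerging_frontier_diff_biUnion_seg_nonempty hδ₀ j (BoxMerging_singleton_ne_univ j a)
  simpa only [Finset.set_biUnion_singleton] using h

/-! ### Crossing events refine along the dyadic hierarchy -/

/-- **Bond-`ℤ²`: the level-`j` crossing event between two segments is the union of the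
level-`(j+1)` crossing events between their children** (square window `(0, δ₀)²`, any mesh `u`;
route notation inlined). [folklore] -/
theorem BoxMerging_discreteCrossing_succ {δ₀ : ℝ} (hδ₀ : 0 < δ₀) (j : ℕ) (u : ℝ)
    (a b : Fin 4 × Fin (2 ^ j)) :
    let Sq : Set ℂ := {z : ℂ | 0 < z.re ∧ z.re < δ₀ ∧ 0 < z.im ∧ z.im < δ₀}
    let seg : (j : ℕ) → Fin 4 × Fin (2 ^ j) → Set ℂ := fun j a =>
      {z : ℂ | (a.1 = 0 ∧ z.im = 0 ∧ δ₀ * ((a.2 : ℕ) : ℝ) / 2 ^ j ≤ z.re ∧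
          z.re ≤ δ₀ * (((a.2 : ℕ) : ℝ) + 1) / 2 ^ j) ∨
        (a.1 = 1 ∧ z.re = δ₀ ∧ δ₀ * ((a.2 : ℕ) : ℝ) / 2 ^ j ≤ z.im ∧
          z.im ≤ δ₀ * (((a.2 : ℕ) : ℝ) + 1) / 2 ^ j) ∨
        (a.1 = 2 ∧ z.im = δ₀ ∧ δ₀ * ((a.2 : ℕ) : ℝ) / 2 ^ j ≤ z.re ∧
          z.re ≤ δ₀ * (((a.2 : ℕ) : ℝ) + 1) / 2 ^ j) ∨
        (a.1 = 3 ∧ z.re = 0 ∧ δ₀ * ((a.2 : ℕ) : ℝ) / 2 ^ j ≤ z.im ∧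
          z.im ≤ δ₀ * (((a.2 : ℕ) : ℝ) + 1) / 2 ^ j)}
    discreteCrossing Sq u (seg j a) (seg j b) =
      ⋃ a' ∈ (Finset.univ.filter fun a' : Fin 4 × Fin (2 ^ (j + 1)) =>
          a'.1 = a.1 ∧ (a'.2 : ℕ) / 2 = (a.2 : ℕ)),
        ⋃ b' ∈ (Finset.univ.filter fun b' : Fin 4 × Fin (2 ^ (j + 1)) =>
            b'.1 = b.1 ∧ (b'.2 : ℕ) / 2 = (b.2 : ℕ)),
          discreteCrossing Sq u (seg (j + 1) a') (seg (j + 1) b') := by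
  intro Sq seg
  have hA : seg j a = ⋃ a' ∈ (Finset.univ.filter fun a' : Fin 4 × Fin (2 ^ (j + 1)) =>
      a'.1 = a.1 ∧ (a'.2 : ℕ) / 2 = (a.2 : ℕ)), seg (j + 1) a' := BoxMerging_seg_succ hδ₀ j a
  have hB : seg j b = ⋃ b' ∈ (Finset.univ.filter fun b' : Fin 4 × Fin (2 ^ (j + 1)) =>
      b'.1 = b.1 ∧ (b'.2 : ℕ) / 2 = (b.2 : ℕ)), seg (j + 1) b' := BoxMerging_seg_succ hδ₀ j b
  have hFA : (frontier Sq \ seg j a).Nonempty := BoxMerging_frontier_diff_seg_nonempty hδ₀ j a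
  have hFB : (frontier Sq \ seg j b).Nonempty := BoxMerging_frontier_diff_seg_nonempty hδ₀ j b
  rw [hA] at hFA ⊢
  rw [hB] at hFB ⊢
  exact BoxMerging_discreteCrossing_biUnion (seg (j + 1)) (BoxMerging_children_nonempty j a)
    (BoxMerging_children_nonempty j b) (fun a' => BoxMerging_seg_nonempty hδ₀ (j + 1) a') hFA hFB

/-- **Site-`𝕋`: the level-`j` crossing event between two segments is the union of the
level-`(j+1)` crossing events between their children** (square window `(0, δ₀)²`, any mesh `u'`;
route notation inlined). [folklore] -/
theorem BoxMerging_triCrossing_succ {δ₀ : ℝ} (hδ₀ : 0 < δ₀) (j : ℕ) (u' : ℝ)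
    (a b : Fin 4 × Fin (2 ^ j)) :
    let Sq : Set ℂ := {z : ℂ | 0 < z.re ∧ z.re < δ₀ ∧ 0 < z.im ∧ z.im < δ₀}
    let seg : (j : ℕ) → Fin 4 × Fin (2 ^ j) → Set ℂ := fun j a =>
      {z : ℂ | (a.1 = 0 ∧ z.im = 0 ∧ δ₀ * ((a.2 : ℕ) : ℝ) / 2 ^ j ≤ z.re ∧
          z.re ≤ δ₀ * (((a.2 : ℕ) : ℝ) + 1) / 2 ^ j) ∨
        (a.1 = 1 ∧ z.re = δ₀ ∧ δ₀ * ((a.2 : ℕ) : ℝ) / 2 ^ j ≤ z.im ∧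
          z.im ≤ δ₀ * (((a.2 : ℕ) : ℝ) + 1) / 2 ^ j) ∨
        (a.1 = 2 ∧ z.im = δ₀ ∧ δ₀ * ((a.2 : ℕ) : ℝ) / 2 ^ j ≤ z.re ∧
          z.re ≤ δ₀ * (((a.2 : ℕ) : ℝ) + 1) / 2 ^ j) ∨
        (a.1 = 3 ∧ z.re = 0 ∧ δ₀ * ((a.2 : ℕ) : ℝ) / 2 ^ j ≤ z.im ∧
          z.im ≤ δ₀ * (((a.2 : ℕ) : ℝ) + 1) / 2 ^ j)}
    triCrossing Sq u' (seg j a) (seg j b) =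
      ⋃ a' ∈ (Finset.univ.filter fun a' : Fin 4 × Fin (2 ^ (j + 1)) =>
          a'.1 = a.1 ∧ (a'.2 : ℕ) / 2 = (a.2 : ℕ)),
        ⋃ b' ∈ (Finset.univ.filter fun b' : Fin 4 × Fin (2 ^ (j + 1)) =>
            b'.1 = b.1 ∧ (b'.2 : ℕ) / 2 = (b.2 : ℕ)),
          triCrossing Sq u' (seg (j + 1) a') (seg (j + 1) b') := by
  intro Sq seg
  have hA : seg j a = ⋃ a' ∈ (Finset.univ.filter fun a' : Fin 4 × Fin (2 ^ (j + 1)) =>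
      a'.1 = a.1 ∧ (a'.2 : ℕ) / 2 = (a.2 : ℕ)), seg (j + 1) a' := BoxMerging_seg_succ hδ₀ j a
  have hB : seg j b = ⋃ b' ∈ (Finset.univ.filter fun b' : Fin 4 × Fin (2 ^ (j + 1)) =>
      b'.1 = b.1 ∧ (b'.2 : ℕ) / 2 = (b.2 : ℕ)), seg (j + 1) b' := BoxMerging_seg_succ hδ₀ j b
  have hFA : (frontier Sq \ seg j a).Nonempty := BoxMerging_frontier_diff_seg_nonempty hδ₀ j a
  have hFB : (frontier Sq \ seg j b).Nonempty := BoxMerging_frontier_diff_seg_nonempty hδ₀ j b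
  rw [hA] at hFA ⊢
  rw [hB] at hFB ⊢
  exact BoxMerging_triCrossing_biUnion (seg (j + 1)) (BoxMerging_children_nonempty j a)
    (BoxMerging_children_nonempty j b) (fun a' => BoxMerging_seg_nonempty hδ₀ (j + 1) a') hFA hFB

end Summit.CriticalPhenomena.CardyFormulaZ2.Theorems
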